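import Literature.Computability.QuantumComplexity.ADHPathModel
import Literature.Computability.QuantumComplexity.BQPRelSubsetAWPPRel
import HarnessLib

/-!
# Paths of an oracle circuit with GUESSED oracle answers, and the pair counts as sums over consistent guesses

Toolkit file for the polynomial-time half of Aaronson–Ambainis' Thm. 23 (arXiv:0911.0996v3, p. 14:
the acceptance probabilities `p_x(A)` of a `BQP^A` machine, their means and influences over the
random oracle, are evaluated by COUNTING computation paths — "by BV techniques"). In the tree's
path-sum model of Clifford+`T` circuits with oracle gates (`OraclePathSums.lean`: `annPathRun`
relative to the oracle `A`, the integer pair counts `annSetA`/`annSetB` with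
`Pr[accept] = (2A + √2 B)/2^{h+1}`, `BQPRelSubsetAWPPRel.acceptProbOn_eq_sqrtTwoForm`) an oracle
gate answers `[q ∈ A]`. A counting machine that does not hold `A` instead GUESSES the answer bit
of every oracle gate (one more coin per gate, as the choice bit of a Hadamard gate) and carries the
list of its reads `(q, a)`; the guess is right iff every read is answered by `A` as guessed. This
file sets up that presentation and proves it computes the same pair counts:

* `ADH.tStepO`, `ADH.tRunO` — the total walk of `ADHPathModel.lean` (`tStep`/`tRun`: label, phase
  mod `8`, validity flag; one coin per gate read with `headBit`) extended to oracle gates: the coin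
  is the guessed answer and is XORed into the answer wire; `lStepO` (the label part),
  `readsO` (the reads `(query string, guessed answer)` in order), `ConsA A` (all guesses answered
  by `A`), `IsClear`/`clearO` (coins `0` at oracle gates, as `annPathRun` requires), `fillA A`
  (replace the coins at oracle gates by `A`'s answers);
* `annPathRun_eq_none_of_not_isClear`, **`tRunO_fillA_spec`** (for clear coins the guessed walk
  with `A`'s answers filled in computes `annPathRun` relative to `A`: endpoint, phase mod `8`,
  validity), `consA_fillA`, `clearO_fillA`, `fillA_clearO` (fill and clear are inverse bijections
  between clear coin lists and `A`-consistent ones);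
* **`sum_annPathRun_eq_sum_consA`** — reindexing a sum over paths relative to `A` as a sum over
  `A`-consistent guessed paths; hence **`annSetA_eq_sum_consA`**, **`annSetB_eq_sum_consA`**: the
  pair counts of `A` are the sums, over PAIRS of `A`-consistent guessed coin strings, of the pair
  terms `pairTermA`/`pairTermB` read off the two total walks; and for a family,
  **`acceptProbOn_eq_sqrtTwoForm_guessed`**: `Pr[F^A accepts x] = (2·ΣA + √2·ΣB)/2^{h+1}` with the
  guessed sums `gSumA F A x`, `gSumB F A x`.

The total walk `tRunO` is what the polynomial-time machine of the sequel computes round by round;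
the consistency indicator is what its expectation over the random oracle replaces by a power of
`2` (`OracleReadCounting.lean`).

## References

* S. Aaronson, A. Ambainis, *The need for structure in quantum speedups*, Theory Comput. 10
  (2014), proof of Thm. 23 (arXiv:0911.0996v3, p. 14) [AaronsonAmbainis2014].
* E. Bernstein, U. Vazirani, *Quantum complexity theory*, SIAM J. Comput. 26 (1997), §8.3–8.4
  (oracle machines; `BQP ⊆ P^{#P}` by summing over paths) [BernsteinVazirani1997].
* L. M. Adleman, J. DeMarrais, M.-D. A. Huang, *Quantum computability*, SIAM J. Comput. 26 (1997),
  §6, Lemma 6.10 (pairs of paths) [AdlemanDeMarraisHuang1997].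
-/

noncomputable section

namespace Literature.Computability.QuantumComplexity

open _root_.Computability Complexity Cryptography

namespace ADH

variable {N : ℕ}

/-! ### The guessed total walk -/

/-- Is the placed gate an oracle gate? [folklore] -/
def isOracleB : QGate cliffordT N → Bool
  | .oracle _ _ => true
  | .gate _ _ => false

/-- **One total step with a guessed oracle answer**: gate symbols step as `tStep`; at an oracle
gate the coin `c` is the guessed answer bit and is XORed into the answer wire (no phase, the flag
is kept). [cite: AaronsonAmbainis2014, proof of Thm. 23 (p. 14)] [cite: BernsteinVazirani1997, §8.3] -/
def tStepO : QGate cliffordT N → Bool → TState N → TState N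
  | .oracle k e, c, (w, φ, v) => (Function.update w (e (Fin.last k)) (w (e (Fin.last k)) ^^ c), φ % 8, v)
  | .gate g e, c, s => tStep (.gate g e) c s

/-- **The guessed total walk** through a gate list, one coin per gate (`headBit`, surplus coins
ignored, missing coins read as `0`). [cite: AaronsonAmbainis2014, proof of Thm. 23 (p. 14)] -/
def tRunO : List (QGate cliffordT N) → List Bool → TState N → TState N
  | [], _, s => s
  | g :: gs, cs, s => tRunO gs cs.tail (tStepO g (headBit cs) s)

/-- The label part of a guessed step (it does not depend on phase and flag). [folklore] -/
def lStepO (g : QGate cliffordT N) (c : Bool) (w : QReg N) : QReg N := (tStepO g c (w, 0, true)).1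

/-- The label after a step is `lStepO`. [folklore] -/
theorem tStepO_fst (g : QGate cliffordT N) (c : Bool) (w : QReg N) (φ : ℕ) (v : Bool) :
    (tStepO g c (w, φ, v)).1 = lStepO g c w := by
  cases g with
  | oracle k e => rfl
  | gate op e => cases op <;> rfl

/-- An invalid guessed walk stays invalid. [folklore] -/
theorem tStepO_false (g : QGate cliffordT N) (c : Bool) (w : QReg N) (φ : ℕ) :
    (tStepO g c (w, φ, false)).2.2 = false := by
  cases g with
  | oracle k e => rfl
  | gate op e => exact tStep_false _ c w φ

/-- An invalid guessed walk stays invalid to the end. [folklore] -/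
theorem tRunO_false (gs : List (QGate cliffordT N)) : ∀ (cs : List Bool) (w : QReg N) (φ : ℕ),
    (tRunO gs cs (w, φ, false)).2.2 = false := by
  induction gs with
  | nil => intro cs w φ; rfl
  | cons g gs ih =>
    intro cs w φ
    simp only [tRunO]
    rcases hs : tStepO g (headBit cs) (w, φ, false) with ⟨w', φ', v'⟩
    have hv : v' = false := by simpa [hs] using tStepO_false g (headBit cs) w φ
    subst hv
    exact ih _ _ _

/-! ### Reads, consistency, clearing and filling -/

/-- **The oracle reads of a guessed walk**: the pairs (query string, guessed answer), in order. [cite: AaronsonAmbainis2014, proof of Thm. 23 (p. 14)] -/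
def readsO : List (QGate cliffordT N) → List Bool → QReg N → List (List Bool × Bool)
  | [], _, _ => []
  | .gate g e :: gs, cs, w => readsO gs cs.tail (lStepO (.gate g e) (headBit cs) w)
  | .oracle k e :: gs, cs, w => (queryOf e w, headBit cs) :: readsO gs cs.tail (lStepO (.oracle k e) (headBit cs) w)

/-- **All guesses are `A`'s answers.** [folklore] -/
def ConsA (A : Language Bool) (gs : List (QGate cliffordT N)) (cs : List Bool) (w : QReg N) : Prop :=
  ∀ r ∈ readsO gs cs w, r.2 = A.boolIndicator r.1

/-- The coins at oracle gates are `0` (the choice lists `annPathRun` accepts). [folklore] -/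
def IsClear : List (QGate cliffordT N) → List Bool → Prop
  | [], _ => True
  | g :: gs, cs => (isOracleB g = true → headBit cs = false) ∧ IsClear gs cs.tail

/-- Clearing the coins at oracle gates (and truncating to one coin per gate). [folklore] -/
def clearO : List (QGate cliffordT N) → List Bool → List Bool
  | [], _ => []
  | g :: gs, cs => (headBit cs && !isOracleB g) :: clearO gs cs.tail

/-- **Filling in `A`'s answers** at the oracle gates, along the walk. [folklore] -/
def fillA (A : Language Bool) : List (QGate cliffordT N) → List Bool → QReg N → List Bool
  | [], _, _ => []
  | .gate g e :: gs, cs, w => headBit cs :: fillA A gs cs.tail (lStepO (.gate g e) (headBit cs) w)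
  | .oracle k e :: gs, cs, w =>
      A.boolIndicator (queryOf e w) :: fillA A gs cs.tail (lStepO (.oracle k e) (A.boolIndicator (queryOf e w)) w)

/-- `fillA` gives one coin per gate. [folklore] -/
@[simp] theorem length_fillA (A : Language Bool) : ∀ (gs : List (QGate cliffordT N)) (cs : List Bool) (w : QReg N),
    (fillA A gs cs w).length = gs.length
  | [], _, _ => rfl
  | .gate g e :: gs, cs, w => by simp [fillA, length_fillA A gs]
  | .oracle k e :: gs, cs, w => by simp [fillA, length_fillA A gs]

/-- `clearO` gives one coin per gate. [folklore] -/
@[simp] theorem length_clearO : ∀ (gs : List (QGate cliffordT N)) (cs : List Bool), (clearO gs cs).length = gs.length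
  | [], _ => rfl
  | g :: gs, cs => by simp [clearO, length_clearO gs]

/-- Cleared coins are clear. [folklore] -/
theorem isClear_clearO : ∀ (gs : List (QGate cliffordT N)) (cs : List Bool), IsClear gs (clearO gs cs)
  | [], _ => trivial
  | g :: gs, cs => ⟨fun h => by simp [clearO, h], by simpa [clearO] using isClear_clearO gs cs.tail⟩

/-- **Filled coins are consistent with `A`.** [folklore] -/
theorem consA_fillA (A : Language Bool) : ∀ (gs : List (QGate cliffordT N)) (cs : List Bool) (w : QReg N),
    ConsA A gs (fillA A gs cs w) w
  | [], _, _ => fun r hr => by simp [readsO] at hr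
  | .gate g e :: gs, cs, w => fun r hr => by
    simp only [fillA, readsO, headBit_cons, List.tail_cons] at hr
    exact consA_fillA A gs cs.tail _ r hr
  | .oracle k e :: gs, cs, w => fun r hr => by
    simp only [fillA, readsO, headBit_cons, List.tail_cons, List.mem_cons] at hr
    rcases hr with rfl | hr
    · rfl
    · exact consA_fillA A gs cs.tail _ r hr

/-- **Clearing the filled coins recovers the clear coins.** [folklore] -/
theorem clearO_fillA (A : Language Bool) : ∀ (gs : List (QGate cliffordT N)) (cs : List Bool) (w : QReg N),
    IsClear gs cs → gs.length ≤ cs.length → clearO gs (fillA A gs cs w) = cs.take gs.length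
  | [], cs, _, _, _ => by simp [clearO]
  | g :: gs, [], w, _, h => by simp at h
  | .gate g e :: gs, c :: cs, w, hc, h => by
    simp only [IsClear, headBit_cons, List.tail_cons, List.length_cons, Nat.add_le_add_iff_right] at hc h ⊢
    simp only [fillA, headBit_cons, List.tail_cons, clearO, isOracleB, Bool.not_false, Bool.and_true,
      List.take_succ_cons, clearO_fillA A gs cs _ hc.2 h]
  | .oracle k e :: gs, c :: cs, w, hc, h => by
    simp only [IsClear, headBit_cons, List.tail_cons, List.length_cons, Nat.add_le_add_iff_right] at hc h ⊢
    have hc0 : c = false := hc.1 rfl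
    subst hc0
    simp only [fillA, List.tail_cons, clearO, headBit_cons, isOracleB, Bool.not_true, Bool.and_false,
      List.take_succ_cons, clearO_fillA A gs cs _ hc.2 h]

/-- The reads after a gate symbol are the reads of the rest. [folklore] -/
theorem readsO_gate (g : CliffordTOp) (e : Fin (cliffordT.arity g) ↪ Fin N) (gs : List (QGate cliffordT N))
    (cs : List Bool) (w : QReg N) :
    readsO (.gate g e :: gs) cs w = readsO gs cs.tail (lStepO (.gate g e) (headBit cs) w) := rfl

/-- The reads at an oracle gate. [folklore] -/
theorem readsO_oracle (k : ℕ) (e : Fin (k + 1) ↪ Fin N) (gs : List (QGate cliffordT N)) (cs : List Bool) (w : QReg N) :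
    readsO (.oracle k e :: gs) cs w =
      (queryOf e w, headBit cs) :: readsO gs cs.tail (lStepO (.oracle k e) (headBit cs) w) := rfl

/-- **Filling the cleared coins of a consistent walk recovers them.** [folklore] -/
theorem fillA_clearO (A : Language Bool) : ∀ (gs : List (QGate cliffordT N)) (cs : List Bool) (w : QReg N),
    ConsA A gs cs w → gs.length ≤ cs.length → fillA A gs (clearO gs cs) w = cs.take gs.length
  | [], cs, _, _, _ => by simp [fillA]
  | g :: gs, [], w, _, h => by simp at h
  | .gate g e :: gs, c :: cs, w, hc, h => by
    simp only [List.length_cons, Nat.add_le_add_iff_right] at h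
    have hc' : ConsA A gs cs (lStepO (.gate g e) c w) := fun r hr => hc r (by simpa [readsO_gate] using hr)
    simp only [clearO, headBit_cons, isOracleB, Bool.not_false, Bool.and_true, List.tail_cons, fillA,
      List.length_cons, List.take_succ_cons, fillA_clearO A gs cs _ hc' h]
  | .oracle k e :: gs, c :: cs, w, hc, h => by
    simp only [List.length_cons, Nat.add_le_add_iff_right] at h
    have hhead : c = A.boolIndicator (queryOf e w) := hc (queryOf e w, c) (by simp [readsO_oracle])
    have hc' : ConsA A gs cs (lStepO (.oracle k e) c w) := fun r hr => hc r (by simp [readsO_oracle, hr])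
    simp only [clearO, headBit_cons, isOracleB, Bool.not_true, Bool.and_false, List.tail_cons, fillA,
      List.length_cons, List.take_succ_cons, ← hhead, fillA_clearO A gs cs _ hc' h]

/-! ### The guessed walk with `A`'s answers computes the path relative to `A` -/

/-- A non-clear coin list is not a path relative to `A` (an oracle gate admits no choice `1`). [folklore] -/
theorem annPathRun_eq_none_of_not_isClear (A : Language Bool) :
    ∀ (gs : List (QGate cliffordT N)) (cs : List Bool) (w : QReg N), gs.length ≤ cs.length →
      ¬ IsClear gs cs → annPathRun (gs.map fun g => (g, A)) w (cs.take gs.length) = none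
  | [], cs, w, _, h => absurd trivial h
  | g :: gs, [], w, hl, _ => by simp at hl
  | g :: gs, c :: cs, w, hl, h => by
    simp only [List.length_cons, Nat.add_le_add_iff_right] at hl
    simp only [IsClear, headBit_cons, List.tail_cons, not_and_or, Classical.not_imp] at h
    simp only [List.map_cons, List.length_cons, List.take_succ_cons, annPathRun]
    rcases h with ⟨ho, hc⟩ | h
    · cases g with
      | gate op e => simp [isOracleB] at ho
      | oracle k e =>
        have hc1 : c = true := by simpa using hc
        subst hc1
        simp [annPathStep]
    · rcases annPathStep (g, A) c w with _ | ⟨w', φ⟩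
      · rfl
      · simp only [annPathRun_eq_none_of_not_isClear A gs cs w' hl h, Option.map_none]

/-- A guessed step from a valid state at a gate symbol agrees with `pathStep`. [folklore] -/
theorem tStepO_true_gate (g : CliffordTOp) (e : Fin (cliffordT.arity g) ↪ Fin N) (c : Bool) (w : QReg N) (φ : ℕ) :
    tStepO (.gate g e) c (w, φ, true) =
      match pathStep (.gate g e) c w with
      | some (w', ψ) => (w', (φ + ψ) % 8, true)
      | none => ((tStepO (.gate g e) c (w, φ, true)).1, (tStepO (.gate g e) c (w, φ, true)).2.1, false) :=
  tStep_true _ c w φ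

/-- **The guessed walk with `A`'s answers filled in computes the path relative to `A`**: from a
valid state, for clear coins (one per gate at least), if the path is valid with endpoint `z` and
phase `ψ` the walk ends at `(z, (φ + ψ) mod 8, valid)`, otherwise invalid.
[cite: AdlemanDeMarraisHuang1997, §6 Lemma 6.10 (proof, step 3)] [cite: BernsteinVazirani1997, §8.3] -/
theorem tRunO_fillA_spec (A : Language Bool) (gs : List (QGate cliffordT N)) :
    ∀ (cs : List Bool) (w : QReg N) (φ : ℕ), φ < 8 → gs.length ≤ cs.length → IsClear gs cs →
      match annPathRun (gs.map fun g => (g, A)) w (cs.take gs.length) with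
      | some (z, ψ) => tRunO gs (fillA A gs cs w) (w, φ, true) = (z, (φ + ψ) % 8, true)
      | none => (tRunO gs (fillA A gs cs w) (w, φ, true)).2.2 = false := by
  induction gs with
  | nil =>
    intro cs w φ hφ _ _
    simp [annPathRun, tRunO, Nat.mod_eq_of_lt hφ]
  | cons g gs ih =>
    intro cs w φ hφ hlen hcl
    cases cs with
    | nil => simp at hlen
    | cons c cs =>
      simp only [List.length_cons, Nat.add_le_add_iff_right] at hlen
      simp only [IsClear, headBit_cons, List.tail_cons] at hcl
      cases g with
      | gate op e =>
        simp only [List.map_cons, List.length_cons, List.take_succ_cons, annPathRun, annPathStep, fillA,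
          headBit_cons, List.tail_cons, tRunO]
        rw [tStepO_true_gate]
        rcases hps : pathStep (.gate op e) c w with _ | ⟨w', ψ⟩
        · simp only
          have : lStepO (.gate op e) c w = (tStepO (.gate op e) c (w, φ, true)).1 := (tStepO_fst _ c w φ true).symm
          rw [this]
          exact tRunO_false gs _ _ _
        · simp only
          have hw' : lStepO (.gate op e) c w = w' := by
            have h1 := tStepO_fst (.gate op e) c w φ true
            rw [tStepO_true_gate, hps] at h1
            exact h1.symm
          rw [hw']
          have h := ih cs w' ((φ + ψ) % 8) (Nat.mod_lt _ (by norm_num)) hlen hcl.2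
          rcases hpr : annPathRun (gs.map fun g => (g, A)) w' (cs.take gs.length) with _ | ⟨z, ψ'⟩
          · simp only [hpr, Option.map_none] at h ⊢
            exact h
          · simp only [hpr, Option.map_some] at h ⊢
            rw [h]
            simp only [Prod.mk.injEq, true_and, and_true]
            rw [Nat.mod_add_mod, Nat.add_assoc]
      | oracle k e =>
        have hc0 : c = false := hcl.1 rfl
        subst hc0
        simp only [List.map_cons, List.length_cons, List.take_succ_cons, annPathRun, annPathStep, fillA,
          List.tail_cons, tRunO, headBit_cons, Bool.false_eq_true, ↓reduceIte]
        have hstep : tStepO (.oracle k e) (A.boolIndicator (queryOf e w)) (w, φ, true) = (oracleTarget A e w, φ, true) := by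
          simp [tStepO, oracleTarget, Nat.mod_eq_of_lt hφ]
        have hl : lStepO (.oracle k e) (A.boolIndicator (queryOf e w)) w = oracleTarget A e w := by
          rw [← tStepO_fst _ _ w φ true, hstep]
        rw [hstep, hl]
        have h := ih cs (oracleTarget A e w) φ hφ hlen hcl.2
        rcases hpr : annPathRun (gs.map fun g => (g, A)) (oracleTarget A e w) (cs.take gs.length) with _ | ⟨z, ψ'⟩
        · simp only [hpr, Option.map_none] at h ⊢
          exact h
        · simp only [hpr, Option.map_some] at h ⊢
          rw [h]
          simp

/-! ### Sums over paths relative to `A` as sums over consistent guessed paths -/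

section Sums

variable (A : Language Bool) (gs : List (QGate cliffordT N)) (w : QReg N)

/-- A coin list as a function on `Fin n` (missing coins `0`). [folklore] -/
def toFn (n : ℕ) (l : List Bool) : Fin n → Bool := fun t => l.getD t false

/-- `ofFn ∘ toFn = id` on lists of the right length. [folklore] -/
theorem ofFn_toFn {n : ℕ} {l : List Bool} (h : l.length = n) : List.ofFn (toFn n l) = l := by
  subst h
  apply List.ext_getElem (by simp)
  intro i h1 h2
  simp [toFn, List.getD_eq_getElem?_getD, h2]

/-- `toFn ∘ ofFn = id`. [folklore] -/
theorem toFn_ofFn {n : ℕ} (b : Fin n → Bool) : toFn n (List.ofFn b) = b := by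
  funext t
  simp [toFn, List.getD_eq_getElem?_getD]

/-- The value read off a total state by a function of (endpoint, phase): `0` on invalid states. [folklore] -/
def onValid {R : Type*} [Zero R] (G : Option (QReg N × ℕ) → R) (s : TState N) : R :=
  if s.2.2 = true then G (some (s.1, s.2.1)) else 0

open scoped Classical in
/-- **Reindexing**: a sum over the paths relative to `A` of a function of (endpoint, phase mod 8)
vanishing on invalid paths equals the sum over the `A`-CONSISTENT guessed coin strings of the same
function read off the guessed total walk. (The bijection: fill in `A`'s answers / clear them.)
[cite: AaronsonAmbainis2014, proof of Thm. 23 (p. 14)] [cite: BernsteinVazirani1997, §8.3] -/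
theorem sum_annPathRun_eq_sum_consA {R : Type*} [AddCommMonoid R] (G : Option (QReg N × ℕ) → R)
    (hG0 : G none = 0) (hG8 : ∀ z ψ, G (some (z, ψ)) = G (some (z, ψ % 8))) :
    ∑ b : Fin gs.length → Bool, G (annPathRun (gs.map fun g => (g, A)) w (List.ofFn b)) =
      ∑ c : Fin gs.length → Bool,
        if ConsA A gs (List.ofFn c) w then onValid G (tRunO gs (List.ofFn c) (w, 0, true)) else 0 := by
  set n := gs.length with hn
  -- the value of the `A`-sum at a clear `b` is the value of the guessed sum at `fill b`
  have hval : ∀ b : Fin n → Bool, IsClear gs (List.ofFn b) →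
      G (annPathRun (gs.map fun g => (g, A)) w (List.ofFn b)) =
        onValid G (tRunO gs (fillA A gs (List.ofFn b) w) (w, 0, true)) := by
    intro b hb
    have h := tRunO_fillA_spec A gs (List.ofFn b) w 0 (by norm_num) (by simp [hn]) hb
    rw [show (List.ofFn b).take gs.length = List.ofFn b from List.take_of_length_le (by simp [hn])] at h
    rcases hpr : annPathRun (gs.map fun g => (g, A)) w (List.ofFn b) with _ | ⟨z, ψ⟩
    · simp only [hpr] at h
      rw [hG0, onValid, if_neg (by simp [h])]
    · simp only [hpr] at h
      rw [onValid, h]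
      simp [hG8 z ψ]
  have hclear : ∀ b : Fin n → Bool, G (annPathRun (gs.map fun g => (g, A)) w (List.ofFn b)) ≠ 0 →
      IsClear gs (List.ofFn b) := by
    intro b hb
    by_contra h
    have := annPathRun_eq_none_of_not_isClear A gs (List.ofFn b) w (by simp [hn]) h
    rw [show (List.ofFn b).take gs.length = List.ofFn b from List.take_of_length_le (by simp [hn])] at this
    exact hb (by rw [this, hG0])
  refine Finset.sum_bij_ne_zero (fun b _ _ => toFn n (fillA A gs (List.ofFn b) w)) (fun b _ _ => Finset.mem_univ _)
    ?_ ?_ ?_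
  · -- injective
    intro b₁ _ h₁ b₂ _ h₂ heq
    have hc₁ := hclear b₁ h₁
    have hc₂ := hclear b₂ h₂
    have heq' : fillA A gs (List.ofFn b₁) w = fillA A gs (List.ofFn b₂) w := by
      rw [← ofFn_toFn (length_fillA A gs (List.ofFn b₁) w), heq, ofFn_toFn (length_fillA A gs (List.ofFn b₂) w)]
    have h1 := clearO_fillA A gs (List.ofFn b₁) w hc₁ (by simp [hn])
    have h2 := clearO_fillA A gs (List.ofFn b₂) w hc₂ (by simp [hn])
    rw [List.take_of_length_le (by simp [hn])] at h1 h2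
    exact List.ofFn_injective (h1.symm.trans (heq' ▸ h2))
  · -- surjective
    intro c _ hc
    have hcons : ConsA A gs (List.ofFn c) w := by
      by_contra h; rw [if_neg h] at hc; exact hc rfl
    refine ⟨toFn n (clearO gs (List.ofFn c)), Finset.mem_univ _, ?_, ?_⟩
    · rw [hval _ (by rw [ofFn_toFn (length_clearO gs _)]; exact isClear_clearO gs _),
        ofFn_toFn (length_clearO gs _), fillA_clearO A gs (List.ofFn c) w hcons (by simp [hn]),
        List.take_of_length_le (by simp [hn])]
      rwa [if_pos hcons] at hc
    · rw [ofFn_toFn (length_clearO gs _), fillA_clearO A gs (List.ofFn c) w hcons (by simp [hn]),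
        List.take_of_length_le (by simp [hn]), toFn_ofFn]
  · -- values
    intro b _ hb
    have hcl := hclear b hb
    rw [hval b hcl, ofFn_toFn (length_fillA A gs _ w), if_pos (consA_fillA A gs _ w)]

/-! ### The pair counts -/

/-- **The `A`-part pair term** of two total states: `reA` of the phase-difference class if both
walks are valid and end at the same label of `S`, else `0`. [cite: AdlemanDeMarraisHuang1997, §6 Lemma 6.10 (proof)] -/
def pairTermA (S : Set (QReg N)) (s s' : TState N) : ℤ :=
  open scoped Classical in
  if s.2.2 = true ∧ s'.2.2 = true ∧ s.1 = s'.1 ∧ s.1 ∈ S then reA ((s.2.1 + 7 * s'.2.1) % 8) else 0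

/-- **The `B`-part pair term.** [cite: AdlemanDeMarraisHuang1997, §6 Lemma 6.10 (proof)] -/
def pairTermB (S : Set (QReg N)) (s s' : TState N) : ℤ :=
  open scoped Classical in
  if s.2.2 = true ∧ s'.2.2 = true ∧ s.1 = s'.1 ∧ s.1 ∈ S then reB ((s.2.1 + 7 * s'.2.1) % 8) else 0

/-- Phase-difference classes only depend on the phases mod `8`. [folklore] -/
theorem pairClass_mod (φ φ' : ℕ) : (φ % 8 + 7 * φ') % 8 = (φ + 7 * φ') % 8 ∧ (φ + 7 * (φ' % 8)) % 8 = (φ + 7 * φ') % 8 := by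
  constructor <;> omega

open scoped Classical in
/-- The two-path summand of `annSetA`/`annSetB`, as a function of the pair of optional (endpoint, phase). [folklore] -/
def pairOpt (f : ℕ → ℤ) (S : Set (QReg N)) : Option (QReg N × ℕ) → Option (QReg N × ℕ) → ℤ
  | some (z₁, φ), some (z₂, φ') => if z₁ = z₂ ∧ z₁ ∈ S then f ((φ + 7 * φ') % 8) else 0
  | _, _ => 0

open scoped Classical in
/-- **The pair counts as sums over consistent guessed pairs** (generic in the class weight `f`). [cite: AaronsonAmbainis2014, proof of Thm. 23 (p. 14)] -/
theorem sum_pairOpt_eq_sum_consA (f : ℕ → ℤ) (S : Set (QReg N)) :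
    ∑ b : Fin gs.length → Bool, ∑ b' : Fin gs.length → Bool,
        pairOpt f S (annPathRun (gs.map fun g => (g, A)) w (List.ofFn b)) (annPathRun (gs.map fun g => (g, A)) w (List.ofFn b')) =
      ∑ c : Fin gs.length → Bool, ∑ c' : Fin gs.length → Bool,
        if ConsA A gs (List.ofFn c) w ∧ ConsA A gs (List.ofFn c') w then
          (let s := tRunO gs (List.ofFn c) (w, 0, true); let s' := tRunO gs (List.ofFn c') (w, 0, true)
           if s.2.2 = true ∧ s'.2.2 = true ∧ s.1 = s'.1 ∧ s.1 ∈ S then f ((s.2.1 + 7 * s'.2.1) % 8) else 0)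
        else 0 := by
  -- inner sums: reindex `b'` for fixed `b`
  have hinner : ∀ o : Option (QReg N × ℕ),
      ∑ b' : Fin gs.length → Bool, pairOpt f S o (annPathRun (gs.map fun g => (g, A)) w (List.ofFn b')) =
        ∑ c' : Fin gs.length → Bool, if ConsA A gs (List.ofFn c') w then
          onValid (pairOpt f S o) (tRunO gs (List.ofFn c') (w, 0, true)) else 0 := by
    intro o
    refine sum_annPathRun_eq_sum_consA (R := ℤ) A gs w (pairOpt f S o) ?_ ?_
    · cases o with
      | none => rfl
      | some p => rfl
    · intro z ψ
      cases o with
      | none => rfl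
      | some p =>
        obtain ⟨z₁, φ⟩ := p
        simp only [pairOpt, (pairClass_mod φ ψ).2]
  simp_rw [hinner]
  rw [Finset.sum_comm]
  -- outer sums: reindex `b` for fixed `c'`
  have houter : ∀ c' : Fin gs.length → Bool,
      ∑ b : Fin gs.length → Bool, (if ConsA A gs (List.ofFn c') w then
          onValid (pairOpt f S (annPathRun (gs.map fun g => (g, A)) w (List.ofFn b))) (tRunO gs (List.ofFn c') (w, 0, true)) else 0) =
        ∑ c : Fin gs.length → Bool, if ConsA A gs (List.ofFn c) w then
          onValid (fun o => if ConsA A gs (List.ofFn c') w then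
            onValid (pairOpt f S o) (tRunO gs (List.ofFn c') (w, 0, true)) else 0) (tRunO gs (List.ofFn c) (w, 0, true)) else 0 := by
    intro c'
    set G : Option (QReg N × ℕ) → ℤ := fun o => if ConsA A gs (List.ofFn c') w then
        onValid (pairOpt f S o) (tRunO gs (List.ofFn c') (w, 0, true)) else 0 with hG
    have h0 : G none = 0 := by simp [hG, onValid, pairOpt]
    have h8 : ∀ z ψ, G (some (z, ψ)) = G (some (z, ψ % 8)) := by
      intro z ψ
      by_cases hc : ConsA A gs (List.ofFn c') w
      · simp only [hG, if_pos hc, onValid, pairOpt, (pairClass_mod ψ _).1]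
      · simp only [hG, if_neg hc]
    exact sum_annPathRun_eq_sum_consA (R := ℤ) A gs w G h0 h8
  simp_rw [houter]
  rw [Finset.sum_comm]
  refine Finset.sum_congr rfl fun c _ => Finset.sum_congr rfl fun c' _ => ?_
  by_cases hc : ConsA A gs (List.ofFn c) w <;> by_cases hc' : ConsA A gs (List.ofFn c') w <;>
    simp only [hc, hc', if_true, if_false, and_true, and_false, onValid, pairOpt]
  · rcases tRunO gs (List.ofFn c) (w, 0, true) with ⟨z, ph, v⟩
    rcases tRunO gs (List.ofFn c') (w, 0, true) with ⟨z', ph', v'⟩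
    cases v <;> cases v' <;> simp
  · rcases tRunO gs (List.ofFn c) (w, 0, true) with ⟨z, ph, v⟩
    cases v <;> simp

open scoped Classical in
/-- Transport of the pair sum along `|gs.map _| = |gs|`. [folklore] -/
theorem sum_pairOpt_cast (f : ℕ → ℤ) (S : Set (QReg N)) {m : ℕ} (h : m = gs.length) :
    (∑ b : Fin m → Bool, ∑ b' : Fin m → Bool,
      pairOpt f S (annPathRun (gs.map fun g => (g, A)) w (List.ofFn b)) (annPathRun (gs.map fun g => (g, A)) w (List.ofFn b'))) =
    ∑ b : Fin gs.length → Bool, ∑ b' : Fin gs.length → Bool,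
      pairOpt f S (annPathRun (gs.map fun g => (g, A)) w (List.ofFn b)) (annPathRun (gs.map fun g => (g, A)) w (List.ofFn b')) := by
  subst h; rfl

open scoped Classical in
/-- **`annSetA` relative to `A` is the sum of `pairTermA` over pairs of `A`-consistent guessed coin
strings.** [cite: AaronsonAmbainis2014, proof of Thm. 23 (p. 14)] [cite: AdlemanDeMarraisHuang1997, §6 Lemma 6.10] -/
theorem annSetA_eq_sum_consA (S : Set (QReg N)) :
    annSetA (gs.map fun g => (g, A)) w S =
      ∑ c : Fin gs.length → Bool, ∑ c' : Fin gs.length → Bool,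
        if ConsA A gs (List.ofFn c) w ∧ ConsA A gs (List.ofFn c') w then
          pairTermA S (tRunO gs (List.ofFn c) (w, 0, true)) (tRunO gs (List.ofFn c') (w, 0, true)) else 0 := by
  have h1 : annSetA (gs.map fun g => (g, A)) w S =
      ∑ b : Fin (gs.map fun g => (g, A)).length → Bool, ∑ b' : Fin (gs.map fun g => (g, A)).length → Bool,
        pairOpt reA S (annPathRun (gs.map fun g => (g, A)) w (List.ofFn b)) (annPathRun (gs.map fun g => (g, A)) w (List.ofFn b')) := by
    unfold annSetA
    refine Finset.sum_congr rfl fun b _ => Finset.sum_congr rfl fun b' _ => ?_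
    unfold pairOpt
    rcases annPathRun (gs.map fun g => (g, A)) w (List.ofFn b) with _ | ⟨z₁, φ⟩ <;>
      rcases annPathRun (gs.map fun g => (g, A)) w (List.ofFn b') with _ | ⟨z₂, φ'⟩ <;> rfl
  rw [h1, sum_pairOpt_cast A gs w reA S (List.length_map _), sum_pairOpt_eq_sum_consA]
  rfl

open scoped Classical in
/-- **`annSetB` relative to `A` is the sum of `pairTermB` over pairs of `A`-consistent guessed coin
strings.** [cite: AaronsonAmbainis2014, proof of Thm. 23 (p. 14)] [cite: AdlemanDeMarraisHuang1997, §6 Lemma 6.10] -/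
theorem annSetB_eq_sum_consA (S : Set (QReg N)) :
    annSetB (gs.map fun g => (g, A)) w S =
      ∑ c : Fin gs.length → Bool, ∑ c' : Fin gs.length → Bool,
        if ConsA A gs (List.ofFn c) w ∧ ConsA A gs (List.ofFn c') w then
          pairTermB S (tRunO gs (List.ofFn c) (w, 0, true)) (tRunO gs (List.ofFn c') (w, 0, true)) else 0 := by
  have h1 : annSetB (gs.map fun g => (g, A)) w S =
      ∑ b : Fin (gs.map fun g => (g, A)).length → Bool, ∑ b' : Fin (gs.map fun g => (g, A)).length → Bool,
        pairOpt reB S (annPathRun (gs.map fun g => (g, A)) w (List.ofFn b)) (annPathRun (gs.map fun g => (g, A)) w (List.ofFn b')) := by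
    unfold annSetB
    refine Finset.sum_congr rfl fun b _ => Finset.sum_congr rfl fun b' _ => ?_
    unfold pairOpt
    rcases annPathRun (gs.map fun g => (g, A)) w (List.ofFn b) with _ | ⟨z₁, φ⟩ <;>
      rcases annPathRun (gs.map fun g => (g, A)) w (List.ofFn b') with _ | ⟨z₂, φ'⟩ <;> rfl
  rw [h1, sum_pairOpt_cast A gs w reB S (List.length_map _), sum_pairOpt_eq_sum_consA]
  rfl

end Sums

end ADH

/-! ### The acceptance probability of a family -/

section Family

open ADH

variable (F : QCircuitFamily cliffordT) (A : Language Bool) (x : List Bool)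

/-- The gate list of `F` at length `|x|`. [folklore] -/
abbrev accGates : List (QGate cliffordT (x.length + F.ancillas x.length)) := (F.circ x.length).gates

open scoped Classical in
/-- **The guessed `A`-part sum** of the family at `x` relative to `A`: over pairs of `A`-consistent
guessed coin strings of the circuit `F_{|x|}` from `|x 0^m⟩`, the pair terms of the accepting labels.
[cite: AaronsonAmbainis2014, proof of Thm. 23 (p. 14)] -/
def gSumA : ℤ :=
  ∑ c : Fin (accGates F x).length → Bool, ∑ c' : Fin (accGates F x).length → Bool,
    if ConsA A (accGates F x) (List.ofFn c) (accInput F x) ∧ ConsA A (accGates F x) (List.ofFn c') (accInput F x) then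
      pairTermA (QCircuit.acceptEvent _) (tRunO (accGates F x) (List.ofFn c) (accInput F x, 0, true))
        (tRunO (accGates F x) (List.ofFn c') (accInput F x, 0, true)) else 0

open scoped Classical in
/-- **The guessed `B`-part sum.** [cite: AaronsonAmbainis2014, proof of Thm. 23 (p. 14)] -/
def gSumB : ℤ :=
  ∑ c : Fin (accGates F x).length → Bool, ∑ c' : Fin (accGates F x).length → Bool,
    if ConsA A (accGates F x) (List.ofFn c) (accInput F x) ∧ ConsA A (accGates F x) (List.ofFn c') (accInput F x) then
      pairTermB (QCircuit.acceptEvent _) (tRunO (accGates F x) (List.ofFn c) (accInput F x, 0, true))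
        (tRunO (accGates F x) (List.ofFn c') (accInput F x, 0, true)) else 0

/-- `accA = gSumA`. [folklore] -/
theorem accA_eq_gSumA : accA F A x = gSumA F A x := annSetA_eq_sum_consA A _ _ _

/-- `accB = gSumB`. [folklore] -/
theorem accB_eq_gSumB : accB F A x = gSumB F A x := annSetB_eq_sum_consA A _ _ _

/-- The Hadamard count does not depend on the oracle. [folklore] -/
theorem accH_eq_hCount : accH F A x = hCount (accGates F x) := by
  simp [accH, annHCount, accGas, List.map_map, Function.comp_def]

/-- **`Pr[F^A accepts x] = (2·gSumA + √2·gSumB)/2^{h+1}`**: the acceptance probability relative to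
`A` as a `√2`-form of sums over pairs of `A`-consistent GUESSED paths — the form whose expectation
over the random oracle a counting machine evaluates. [cite: AaronsonAmbainis2014, proof of Thm. 23 (p. 14)] [cite: AdlemanDeMarraisHuang1997, §6 Lemma 6.10] -/
theorem acceptProbOn_eq_sqrtTwoForm_guessed :
    F.acceptProbOn A x = SqrtTwoDyadic.sqrtTwoForm (gSumA F A x) (gSumB F A x) (hCount (accGates F x)) := by
  rw [acceptProbOn_eq_sqrtTwoForm, accA_eq_gSumA, accB_eq_gSumB, accH_eq_hCount]

end Family

end Literature.Computability.QuantumComplexity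

end
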